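import Mathlib
import Literature.NumberTheory.Sieve.PolynomialValuesSieveSequence
import HarnessLib

/-!
# Route `AlmostPrimeZeros`, support item `SystemMertens` (stmt-Parity-11293): counting lemmas

Elementary counting lemmas for the mean value of the CAPPED statistic
`s(m) = Σ_{p^v ∥ m} min(v, 2)` (in Lean `m.factorization.sum fun _ v => min v 2`) along the values
of an integer polynomial, used by the proof of
`Summit.Parity.BatemanHorn.Theses.AlmostPrimeZeros.SystemMertens`:

* `capped_eq_card_add_card` — `s(m) = ω(m) + #{p ∣ m : p² ∣ m}`;
* `pow_card_le_of_forall`, `card_le_of_forall_pow_dvd` — a positive `m ≤ C·Y^d` (`Y ≥ 2`) has at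
  most `d + C` prime factors `p` with `Y ≤ p^e`, `p^e ∣ m` (`Y^N ≤ ∏ p^e ≤ m`);
* `capped_le_card_add`, `sum_capped_le`, `le_sum_capped` — the pointwise split of `s(G n)` at
  `p ≤ x` / `p ≥ x + 1` and `p² ≤ x` / `p² ≥ x + 1`, summed over `0 ≤ n ≤ x` with the order of
  summation exchanged (`sum_card_filter_comm`; prime sets `Nat.primesLE x`);
* `card_filter_range_dvd_eval_le`, `le_card_filter_range_dvd_eval` — in `[0, N)` the congruence
  `q ∣ g(n)` has between `ρ_g(q)·⌊N/q⌋` and `ρ_g(q)·(⌊N/q⌋ + 1)` solutions (periodicity modulo `q`;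
  the residues are counted by the tree's `Literature.NumberTheory.Sieve.polyRootCountMod ![g] q`);
* `natAbs_eval_le`, `toNat_eval_le` — `|g(n)| ≤ H(g)·(x+1)^{deg g}` for `0 ≤ n ≤ x`, with
  `H(g) = Σ_j |coeff_j(g)|`.

Everything is [folklore]; no definitions are introduced.
-/

namespace Summit.Parity.BatemanHorn.Theorems.AlmostPrimeZeros.SystemMertens

open Finset Polynomial
open Literature.NumberTheory.Sieve

/-! ### The capped statistic -/

/-- `s(m) = Σ_{p^v ∥ m} min(v,2) = ω(m) + #{p prime : p² ∣ m}` (for `p ∣ m`, `min(v_p, 2) = 1 + [p² ∣ m]`;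
both sides vanish at `m = 0`). [folklore] -/
theorem capped_eq_card_add_card (m : ℕ) :
    (m.factorization.sum fun _ v => min v 2) =
      #m.primeFactors + #(m.primeFactors.filter fun p => p ^ 2 ∣ m) := by
  rcases eq_or_ne m 0 with rfl | hm
  · simp
  unfold Finsupp.sum
  rw [Nat.support_factorization, card_eq_sum_ones, card_eq_sum_ones, sum_filter,
    ← sum_add_distrib]
  refine sum_congr rfl fun p hp => ?_
  have hp' : p.Prime := Nat.prime_of_mem_primeFactors hp
  have h1 : 0 < m.factorization p :=
    hp'.factorization_pos_of_dvd hm (Nat.dvd_of_mem_primeFactors hp)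
  show min (m.factorization p) 2 = 1 + if p ^ 2 ∣ m then 1 else 0
  by_cases h2 : p ^ 2 ∣ m
  · rw [if_pos h2]
    have := (hp'.pow_dvd_iff_le_factorization hm).1 h2
    omega
  · rw [if_neg h2]
    have : ¬ 2 ≤ m.factorization p := fun h => h2 ((hp'.pow_dvd_iff_le_factorization hm).2 h)
    omega

/-! ### Large prime-power divisors are few -/

/-- If every `p ∈ S` is a prime factor of `m ≠ 0` with `e ≤ v_p(m)` and `Y ≤ p^e`, then
`Y^{#S} ≤ m` (`Y^{#S} = ∏_{p ∈ S} Y ≤ ∏_{p ∈ S} p^{v_p(m)} ≤ ∏_{p ∣ m} p^{v_p(m)} = m`). [folklore] -/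
theorem pow_card_le_of_forall {m Y e : ℕ} (hm : m ≠ 0) (S : Finset ℕ)
    (hS : ∀ p ∈ S, p ∈ m.primeFactors ∧ e ≤ m.factorization p ∧ Y ≤ p ^ e) :
    Y ^ #S ≤ m := by
  have hsub : S ⊆ m.primeFactors := fun p hp => (hS p hp).1
  calc Y ^ #S = ∏ _p ∈ S, Y := by rw [prod_const]
    _ ≤ ∏ p ∈ S, p ^ m.factorization p := by
        refine prod_le_prod' fun p hp => ?_
        obtain ⟨hpm, he, hY⟩ := hS p hp
        exact hY.trans (Nat.pow_le_pow_right (Nat.prime_of_mem_primeFactors hpm).pos he)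
    _ ≤ ∏ p ∈ m.primeFactors, p ^ m.factorization p :=
        prod_le_prod_of_subset_of_one_le' hsub fun p hp _ =>
          Nat.one_le_pow _ _ (Nat.prime_of_mem_primeFactors hp).pos
    _ = m.factorization.prod fun p k => p ^ k := by
        rw [Finsupp.prod, Nat.support_factorization]
    _ = m := Nat.prod_factorization_pow_eq_self hm

/-- A positive `m ≤ C·Y^d` with `Y ≥ 2` has at most `d + C` prime factors `p` with `e ≤ v_p(m)` and
`Y ≤ p^e` (else `Y^{#S} ≥ Y^d · 2^{C+1} > C·Y^d ≥ m`). [folklore] -/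
theorem card_le_of_forall_pow_dvd {m C Y d e : ℕ} (hm : m ≠ 0) (hY : 2 ≤ Y) (hmC : m ≤ C * Y ^ d)
    (S : Finset ℕ) (hS : ∀ p ∈ S, p ∈ m.primeFactors ∧ e ≤ m.factorization p ∧ Y ≤ p ^ e) :
    #S ≤ d + C := by
  by_contra h
  rw [not_le] at h
  have h1 : Y ^ #S ≤ m := pow_card_le_of_forall hm S hS
  have hYd : 0 < Y ^ d := pow_pos (by omega) d
  have h2 : C < 2 ^ (C + 1) := Nat.lt_two_pow_self.trans (Nat.pow_lt_pow_right (by norm_num) (by omega))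
  have h3 : 2 ^ (C + 1) ≤ Y ^ (C + 1) := Nat.pow_le_pow_left hY _
  have h4 : C * Y ^ d < Y ^ #S :=
    calc C * Y ^ d < 2 ^ (C + 1) * Y ^ d := Nat.mul_lt_mul_of_pos_right h2 hYd
      _ ≤ Y ^ (C + 1) * Y ^ d := Nat.mul_le_mul_right _ h3
      _ = Y ^ (d + C + 1) := by rw [← pow_add]; ring_nf
      _ ≤ Y ^ #S := Nat.pow_le_pow_right (by omega) (by omega)
  omega

/-! ### Pointwise splitting of the capped statistic -/

/-- For `m ≤ C·(x+1)^d`, `x ≥ 1`: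
`s(m) ≤ #{p ∣ m : p ≤ x} + #{p ∣ m : p² ∣ m, p² ≤ x} + 2(d + C)` — the prime factors `p ≥ x + 1`
and the prime-square factors `p² ≥ x + 1` number at most `d + C` each. [folklore] -/
theorem capped_le_card_add {m x d C : ℕ} (hx : 1 ≤ x) (hmC : m ≤ C * (x + 1) ^ d) :
    (m.factorization.sum fun _ v => min v 2) ≤
      #(m.primeFactors.filter fun p => p ≤ x) +
        #(m.primeFactors.filter fun p => p ^ 2 ∣ m ∧ p ^ 2 ≤ x) + 2 * (d + C) := by
  rcases eq_or_ne m 0 with rfl | hm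
  · simp
  rw [capped_eq_card_add_card]
  have hA := card_filter_add_card_filter_not (s := m.primeFactors) (fun p => p ≤ x)
  have hB := card_filter_add_card_filter_not
    (s := m.primeFactors.filter fun p => p ^ 2 ∣ m) (fun p => p ^ 2 ≤ x)
  have hA' : #(m.primeFactors.filter fun p => ¬ p ≤ x) ≤ d + C := by
    refine card_le_of_forall_pow_dvd (e := 1) hm (by omega : 2 ≤ x + 1) hmC _ fun p hp => ?_
    rw [mem_filter] at hp
    refine ⟨hp.1, ?_, by rw [pow_one]; omega⟩
    exact (Nat.prime_of_mem_primeFactors hp.1).factorization_pos_of_dvd hm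
      (Nat.dvd_of_mem_primeFactors hp.1)
  have hB' : #((m.primeFactors.filter fun p => p ^ 2 ∣ m).filter fun p => ¬ p ^ 2 ≤ x) ≤ d + C := by
    refine card_le_of_forall_pow_dvd (e := 2) hm (by omega : 2 ≤ x + 1) hmC _ fun p hp => ?_
    simp only [mem_filter] at hp
    obtain ⟨⟨hpm, hsq⟩, hx⟩ := hp
    refine ⟨hpm, ?_, by omega⟩
    exact ((Nat.prime_of_mem_primeFactors hpm).pow_dvd_iff_le_factorization hm).1 hsq
  have hB'' : #((m.primeFactors.filter fun p => p ^ 2 ∣ m).filter fun p => p ^ 2 ≤ x) =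
      #(m.primeFactors.filter fun p => p ^ 2 ∣ m ∧ p ^ 2 ≤ x) := by
    rw [filter_filter]
  omega

/-- Exchange of the order of summation for a counting double sum:
`Σ_{a ∈ s} #{b ∈ t : r a b} = Σ_{b ∈ t} #{a ∈ s : r a b}`. [folklore] -/
theorem sum_card_filter_comm {α β : Type*} (s : Finset α) (t : Finset β) (r : α → β → Prop)
    [∀ a b, Decidable (r a b)] :
    ∑ a ∈ s, #(t.filter fun b => r a b) = ∑ b ∈ t, #(s.filter fun a => r a b) := by
  simp_rw [card_eq_sum_ones, sum_filter]
  exact sum_comm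

/-- **Upper splitting, summed.** If `x ≥ 1` and `G n ≤ C·(x+1)^d` for `0 ≤ n ≤ x`, then
`Σ_{n ≤ x} s(G n) ≤ Σ_{p ≤ x} #{n ≤ x : p ∣ G n ≠ 0} + Σ_{p ≤ x, p² ≤ x} #{n ≤ x : p² ∣ G n ≠ 0}
  + 2(d + C)(x + 1)` (sums over primes `p`). [folklore] -/
theorem sum_capped_le (G : ℕ → ℕ) {x d C : ℕ} (hx : 1 ≤ x)
    (hG : ∀ n ∈ range (x + 1), G n ≤ C * (x + 1) ^ d) :
    ∑ n ∈ range (x + 1), ((G n).factorization.sum fun _ v => min v 2) ≤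
      ∑ p ∈ Nat.primesLE x, #((range (x + 1)).filter fun n => p ∣ G n ∧ G n ≠ 0) +
        ∑ p ∈ (Nat.primesLE x).filter (fun p => p ^ 2 ≤ x),
          #((range (x + 1)).filter fun n => p ^ 2 ∣ G n ∧ G n ≠ 0) +
        2 * (d + C) * (x + 1) := by
  have h1 : ∀ n ∈ range (x + 1), ((G n).factorization.sum fun _ v => min v 2) ≤
      #((Nat.primesLE x).filter fun p => p ∣ G n ∧ G n ≠ 0) +
        #(((Nat.primesLE x).filter (fun p => p ^ 2 ≤ x)).filter
          fun p => p ^ 2 ∣ G n ∧ G n ≠ 0) + 2 * (d + C) := by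
    intro n hn
    have hE1 : (G n).primeFactors.filter (fun p => p ≤ x) =
        (Nat.primesLE x).filter fun p => p ∣ G n ∧ G n ≠ 0 := by
      ext p
      simp only [mem_filter, Nat.mem_primeFactors, Nat.mem_primesLE]
      constructor
      · rintro ⟨⟨hp, hd, h0⟩, hx⟩
        exact ⟨⟨hx, hp⟩, hd, h0⟩
      · rintro ⟨⟨hx, hp⟩, hd, h0⟩
        exact ⟨⟨hp, hd, h0⟩, hx⟩
    have hE2 : (G n).primeFactors.filter (fun p => p ^ 2 ∣ G n ∧ p ^ 2 ≤ x) =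
        ((Nat.primesLE x).filter (fun p => p ^ 2 ≤ x)).filter
          fun p => p ^ 2 ∣ G n ∧ G n ≠ 0 := by
      ext p
      simp only [mem_filter, Nat.mem_primeFactors, Nat.mem_primesLE]
      constructor
      · rintro ⟨⟨hp, -, h0⟩, hsq, hx⟩
        have : p ≤ p ^ 2 := Nat.le_self_pow two_ne_zero p
        exact ⟨⟨⟨by omega, hp⟩, hx⟩, hsq, h0⟩
      · rintro ⟨⟨⟨-, hp⟩, hx⟩, hsq, h0⟩
        exact ⟨⟨hp, dvd_trans (dvd_pow_self p two_ne_zero) hsq, h0⟩, hsq, hx⟩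
    have := capped_le_card_add hx (hG n hn)
    rw [hE1, hE2] at this
    exact this
  calc ∑ n ∈ range (x + 1), ((G n).factorization.sum fun _ v => min v 2)
      ≤ ∑ n ∈ range (x + 1),
          (#((Nat.primesLE x).filter fun p => p ∣ G n ∧ G n ≠ 0) +
            #(((Nat.primesLE x).filter (fun p => p ^ 2 ≤ x)).filter
              fun p => p ^ 2 ∣ G n ∧ G n ≠ 0) + 2 * (d + C)) := sum_le_sum h1
    _ = _ := by
        rw [sum_add_distrib, sum_add_distrib, sum_const, card_range, smul_eq_mul,
          sum_card_filter_comm (range (x + 1)) (Nat.primesLE x) (fun n p => p ∣ G n ∧ G n ≠ 0),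
          sum_card_filter_comm (range (x + 1)) ((Nat.primesLE x).filter fun p => p ^ 2 ≤ x)
            (fun n p => p ^ 2 ∣ G n ∧ G n ≠ 0)]
        ring

/-- **Lower splitting, summed.** `Σ_{p ≤ x prime} #{n ≤ x : p ∣ G n ≠ 0} ≤ Σ_{n ≤ x} s(G n)`
(`s(m) ≥ ω(m) ≥ #{p ≤ x : p ∣ m}`). [folklore] -/
theorem le_sum_capped (G : ℕ → ℕ) (x : ℕ) :
    ∑ p ∈ Nat.primesLE x, #((range (x + 1)).filter fun n => p ∣ G n ∧ G n ≠ 0) ≤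
      ∑ n ∈ range (x + 1), ((G n).factorization.sum fun _ v => min v 2) := by
  rw [← sum_card_filter_comm (range (x + 1)) (Nat.primesLE x) (fun n p => p ∣ G n ∧ G n ≠ 0)]
  refine sum_le_sum fun n _ => ?_
  rw [capped_eq_card_add_card]
  refine le_trans (card_le_card fun p hp => ?_) (Nat.le_add_right _ _)
  simp only [mem_filter, Nat.mem_primesLE, Nat.mem_primeFactors] at hp ⊢
  exact ⟨hp.1.2, hp.2.1, hp.2.2⟩

/-! ### Solutions of `q ∣ g(n)` in an initial segment -/

/-- In `[0, N)`, `#{n : q ∣ g(n)} ≤ ρ_g(q)·(⌊N/q⌋ + 1)` for `q ≥ 1` (each admissible residue class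
modulo `q` has at most `⌊N/q⌋ + 1` representatives below `N`). [folklore] -/
theorem card_filter_range_dvd_eval_le (g : ℤ[X]) {q : ℕ} (hq : 0 < q) (N : ℕ) :
    #((range N).filter fun n : ℕ => (q : ℤ) ∣ g.eval (n : ℤ)) ≤
      polyRootCountMod ![g] q * (N / q + 1) := by
  rw [card_filter_dvd_eval_eq_sum g (range N) hq, polyRootCountMod_single, card_eq_sum_ones,
    sum_mul, one_mul]
  refine sum_le_sum fun s _ => ?_
  rw [← Nat.count_eq_card_filter_range, Nat.count_modEq_card N hq s]
  split_ifs <;> omega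

/-- In `[0, N)`, `ρ_g(q)·⌊N/q⌋ ≤ #{n : q ∣ g(n)}` for `q ≥ 1` (each residue class modulo `q` has at
least `⌊N/q⌋` representatives below `N`). [folklore] -/
theorem le_card_filter_range_dvd_eval (g : ℤ[X]) {q : ℕ} (hq : 0 < q) (N : ℕ) :
    polyRootCountMod ![g] q * (N / q) ≤
      #((range N).filter fun n : ℕ => (q : ℤ) ∣ g.eval (n : ℤ)) := by
  rw [card_filter_dvd_eval_eq_sum g (range N) hq, polyRootCountMod_single, card_eq_sum_ones,
    sum_mul, one_mul]
  refine sum_le_sum fun s _ => ?_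
  rw [← Nat.count_eq_card_filter_range, Nat.count_modEq_card N hq s]
  split_ifs <;> omega

/-! ### Size of the values -/

/-- `|g(n)| ≤ (Σ_j |coeff_j g|)·(x+1)^{deg g}` for `0 ≤ n ≤ x`. [folklore] -/
theorem natAbs_eval_le (g : ℤ[X]) {n x : ℕ} (hn : n ≤ x) :
    (g.eval (n : ℤ)).natAbs ≤
      (∑ j ∈ range (g.natDegree + 1), (g.coeff j).natAbs) * (x + 1) ^ g.natDegree := by
  rw [eval_eq_sum_range, sum_mul]
  refine (Int.natAbs_sum_le _ _).trans (sum_le_sum fun j hj => ?_)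
  rw [mem_range] at hj
  rw [Int.natAbs_mul, Int.natAbs_pow, Int.natAbs_natCast]
  refine Nat.mul_le_mul_left _ ?_
  calc n ^ j ≤ (x + 1) ^ j := Nat.pow_le_pow_left (by omega) _
    _ ≤ (x + 1) ^ g.natDegree := Nat.pow_le_pow_right (by omega) (by omega)

/-- `(g(n)).toNat ≤ (Σ_j |coeff_j g|)·(x+1)^{deg g}` for `0 ≤ n ≤ x`. [folklore] -/
theorem toNat_eval_le (g : ℤ[X]) {n x : ℕ} (hn : n ≤ x) :
    (g.eval (n : ℤ)).toNat ≤
      (∑ j ∈ range (g.natDegree + 1), (g.coeff j).natAbs) * (x + 1) ^ g.natDegree :=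
  le_trans (by omega) (natAbs_eval_le g hn)

/-! ### Prime factors of the positive part of an integer -/

/-- For a prime `p`: `p ∣ z.toNat ≠ 0` iff `0 < z` and `p ∣ z` in `ℤ`. [folklore] -/
theorem dvd_toNat_and_ne_zero_iff {q : ℕ} {z : ℤ} :
    (q ∣ z.toNat ∧ z.toNat ≠ 0) ↔ (0 < z ∧ (q : ℤ) ∣ z) := by
  constructor
  · rintro ⟨hd, h0⟩
    have hz : 0 < z := by
      by_contra h
      exact h0 (Int.toNat_eq_zero.mpr (not_lt.mp h))
    refine ⟨hz, ?_⟩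
    rw [← Int.toNat_of_nonneg hz.le]
    exact Int.natCast_dvd_natCast.mpr hd
  · rintro ⟨hz, hd⟩
    refine ⟨?_, ?_⟩
    · rw [← Int.natCast_dvd_natCast, Int.toNat_of_nonneg hz.le]
      exact hd
    · rw [Ne, Int.toNat_eq_zero, not_le]
      exact hz

end Summit.Parity.BatemanHorn.Theorems.AlmostPrimeZeros.SystemMertens
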